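import Literature.Analysis.SpecialFunctions.HeckeKloostermanIntegral
import Mathlib
import HarnessLib

/-!
# The standard Cauchy law as a measure on `ℝ`: characteristic function and a scale-free monotonicity inequality

Helper (definition-free) for the by-name rung `TwoMirrorLFConstancy` / `HexagonalLFConstancy` of LINE g19-A «transverse
slice» on crux ⟨stmt-QuantumFields-23035⟩ `F4SubCurvatureDoor.ShortRootRigidity` (rung file
`Cruxes/ShortRootRigidity/Lines/transverse_slice_rung_bounded.lean`).  The planar Laplace–Fourier transform
`k(t, x) = ∫ e^{-E|t|} cos(p x) dμ(E, p)` of a finite measure is the Fourier transform of the FINITE planar measure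
«law of `(E·ξ, ±p)` with `ξ` standard Cauchy», because `e^{-E|t|} = ∫ e^{itEξ} dC(ξ)`.  This file packages the Cauchy
law `C = (π⁻¹(1+ξ²)⁻¹) dξ` (written inline as `volume.withDensity …`, no new definitions): it is a probability measure, its
characteristic function is `e^{-|t|}` (from the tree's `Literature.Analysis.SpecialFunctions.heckeKloostermanH_one_one`,
Freitag's `h(y;1;1) = πe^{-|y|}`), and — the engine of the rung — the SCALE-FREE MONOTONICITY INEQUALITY
`cauchy_preimage_mul_Icc_ratio`: since the density is radially decreasing, for `E > 0`, an inner interval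
`[u', v'] ⊆ [-u, u]` and an outer interval `[u, v]` of length `≤ ℓ`,
`(v' - u')/ℓ · C{ξ : Eξ ∈ [u, v]} ≤ C{ξ : Eξ ∈ [u', v']}`, uniformly in the scale `E`; plus the Cauchy TAIL on a far box
`C{ξ : Eξ ∈ [ρ, ρ+1]} ≥ π⁻¹E/(E² + (ρ+1)²)`.

HONEST LABEL: classical bookkeeping about the Cauchy distribution; nothing here is specific to Yang–Mills, and nothing about
⟨23035⟩, R2d or any summit is proved by this file.
-/

noncomputable section

open MeasureTheory Set Filter Topology
open scoped ENNReal NNReal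

namespace Summit.QuantumFields.YangMills.Theorems.F4SubCurvatureDoorCauchyKernel

/-- The Cauchy density `π⁻¹(1+ξ²)⁻¹` is strictly positive. -/
theorem cauchyPDF_pos (x : ℝ) : 0 < Real.pi⁻¹ * (1 + x ^ 2)⁻¹ := by positivity

/-- The Cauchy density is continuous. -/
theorem continuous_cauchyPDF : Continuous fun x : ℝ => Real.pi⁻¹ * (1 + x ^ 2)⁻¹ := by
  have h : ∀ x : ℝ, (1 : ℝ) + x ^ 2 ≠ 0 := fun x => by positivity
  exact continuous_const.mul ((continuous_const.add (continuous_pow 2)).inv₀ h)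

/-- The Cauchy density is measurable (in the `ℝ≥0∞` form used by `withDensity`). -/
theorem measurable_cauchyPDF_ennreal : Measurable fun x : ℝ => ENNReal.ofReal (Real.pi⁻¹ * (1 + x ^ 2)⁻¹) :=
  continuous_cauchyPDF.measurable.ennreal_ofReal

/-- The Cauchy density is radially decreasing: `|x| ≤ |y| → π⁻¹(1+y²)⁻¹ ≤ π⁻¹(1+x²)⁻¹`. -/
theorem cauchyPDF_le_of_abs_le {x y : ℝ} (h : |x| ≤ |y|) :
    Real.pi⁻¹ * (1 + y ^ 2)⁻¹ ≤ Real.pi⁻¹ * (1 + x ^ 2)⁻¹ := by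
  have hx2 : x ^ 2 ≤ y ^ 2 := sq_le_sq.mpr h
  refine mul_le_mul_of_nonneg_left ?_ (by positivity)
  exact inv_anti₀ (by positivity) (by linarith)

/-- The Cauchy density is integrable. -/
theorem integrable_cauchyPDF : Integrable fun x : ℝ => Real.pi⁻¹ * (1 + x ^ 2)⁻¹ :=
  integrable_inv_one_add_sq.const_mul _

/-- The Cauchy density has total integral `1` (`∫ (1+ξ²)⁻¹ = π`). -/
theorem integral_cauchyPDF : ∫ x : ℝ, Real.pi⁻¹ * (1 + x ^ 2)⁻¹ = 1 := by
  rw [integral_const_mul, integral_univ_inv_one_add_sq, inv_mul_cancel₀ Real.pi_pos.ne']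

/-- `C(s) = ∫_s π⁻¹(1+ξ²)⁻¹ dξ` on measurable sets. -/
theorem cauchy_apply {s : Set ℝ} (hs : MeasurableSet s) :
    (volume.withDensity fun x : ℝ => ENNReal.ofReal (Real.pi⁻¹ * (1 + x ^ 2)⁻¹)) s
      = ∫⁻ x in s, ENNReal.ofReal (Real.pi⁻¹ * (1 + x ^ 2)⁻¹) :=
  withDensity_apply _ hs

/-- **The Cauchy law is a probability measure.** -/
theorem isProbabilityMeasure_cauchy :
    IsProbabilityMeasure (volume.withDensity fun x : ℝ => ENNReal.ofReal (Real.pi⁻¹ * (1 + x ^ 2)⁻¹)) := by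
  constructor
  rw [cauchy_apply MeasurableSet.univ, Measure.restrict_univ,
    ← ofReal_integral_eq_lintegral_ofReal integrable_cauchyPDF (ae_of_all _ fun x => (cauchyPDF_pos x).le),
    integral_cauchyPDF, ENNReal.ofReal_one]

/-- Integration against the Cauchy law = integration against its density. -/
theorem integral_cauchy {F : Type*} [NormedAddCommGroup F] [NormedSpace ℝ F] (g : ℝ → F) :
    ∫ x, g x ∂(volume.withDensity fun x : ℝ => ENNReal.ofReal (Real.pi⁻¹ * (1 + x ^ 2)⁻¹))
      = ∫ x : ℝ, (Real.pi⁻¹ * (1 + x ^ 2)⁻¹) • g x := by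
  rw [integral_withDensity_eq_integral_toReal_smul measurable_cauchyPDF_ennreal
      (ae_of_all _ fun x => ENNReal.ofReal_lt_top)]
  refine integral_congr_ae (ae_of_all _ fun x => ?_)
  dsimp only
  rw [ENNReal.toReal_ofReal (cauchyPDF_pos x).le]

/-- **The characteristic function of the Cauchy law**: `∫ e^{itξ} dC(ξ) = e^{-|t|}` (Freitag's `h(y;1;1) = πe^{-|y|}`,
`Literature.Analysis.SpecialFunctions.heckeKloostermanH_one_one`). -/
theorem integral_cexp_cauchy (t : ℝ) :
    ∫ x : ℝ, Complex.exp ((t : ℂ) * (x : ℂ) * Complex.I)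
        ∂(volume.withDensity fun x : ℝ => ENNReal.ofReal (Real.pi⁻¹ * (1 + x ^ 2)⁻¹))
      = ((Real.exp (-|t|) : ℝ) : ℂ) := by
  rw [integral_cauchy]
  have h := Literature.Analysis.SpecialFunctions.heckeKloostermanH_one_one (-t)
  unfold Literature.Analysis.SpecialFunctions.heckeKloostermanH at h
  simp_rw [Literature.Analysis.SpecialFunctions.heckeKloostermanKernel_one_one] at h
  rw [abs_neg] at h
  have e : ∀ x : ℝ, (Real.pi⁻¹ * (1 + x ^ 2)⁻¹ : ℝ) • Complex.exp ((t : ℂ) * (x : ℂ) * Complex.I)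
      = ((Real.pi⁻¹ : ℝ) : ℂ) *
        ((((1 + x ^ 2 : ℝ) : ℂ))⁻¹ * Complex.exp (-(Complex.I * (((-t : ℝ)) : ℂ) * (x : ℂ)))) := by
    intro x
    rw [Complex.real_smul]
    have : -(Complex.I * (((-t : ℝ)) : ℂ) * (x : ℂ)) = (t : ℂ) * (x : ℂ) * Complex.I := by
      push_cast; ring
    rw [this]
    push_cast
    ring
  simp_rw [e]
  rw [integral_const_mul, h, ← mul_assoc]
  have hπ : ((Real.pi⁻¹ : ℝ) : ℂ) * (Real.pi : ℂ) = 1 := by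
    push_cast
    exact inv_mul_cancel₀ (by exact_mod_cast Real.pi_pos.ne')
  rw [hπ, one_mul]

/-- The characteristic function of the Cauchy law in Mathlib's `charFun` normalisation: `charFun C t = e^{-|t|}`. -/
theorem charFun_cauchy (t : ℝ) :
    charFun (volume.withDensity fun x : ℝ => ENNReal.ofReal (Real.pi⁻¹ * (1 + x ^ 2)⁻¹)) t
      = ((Real.exp (-|t|) : ℝ) : ℂ) := by
  rw [charFun_apply_real]
  exact integral_cexp_cauchy t

/-- Scaled characteristic function: `∫ e^{i a E ξ} dC(ξ) = e^{-|aE|}`. -/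
theorem integral_cexp_mul_cauchy (a E : ℝ) :
    ∫ x : ℝ, Complex.exp (((a * (E * x) : ℝ) : ℂ) * Complex.I)
        ∂(volume.withDensity fun x : ℝ => ENNReal.ofReal (Real.pi⁻¹ * (1 + x ^ 2)⁻¹))
      = ((Real.exp (-|a * E|) : ℝ) : ℂ) := by
  rw [← integral_cexp_cauchy (a * E)]
  refine integral_congr_ae (ae_of_all _ fun x => ?_)
  dsimp only
  push_cast
  ring_nf

/-- Upper bound: on an interval `[a, b]` to the right of `u ≥ 0` the Cauchy law has mass `≤ (b - a)·π⁻¹(1+u²)⁻¹`. -/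
theorem cauchy_Icc_le {u a b : ℝ} (hu : 0 ≤ u) (hua : u ≤ a) :
    (volume.withDensity fun x : ℝ => ENNReal.ofReal (Real.pi⁻¹ * (1 + x ^ 2)⁻¹)) (Icc a b)
      ≤ ENNReal.ofReal ((b - a) * (Real.pi⁻¹ * (1 + u ^ 2)⁻¹)) := by
  rcases le_or_gt a b with hab | hab
  · rw [cauchy_apply measurableSet_Icc]
    calc ∫⁻ x in Icc a b, ENNReal.ofReal (Real.pi⁻¹ * (1 + x ^ 2)⁻¹)
        ≤ ∫⁻ _ in Icc a b, ENNReal.ofReal (Real.pi⁻¹ * (1 + u ^ 2)⁻¹) := by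
          refine setLIntegral_mono measurable_const fun x hx => ?_
          refine ENNReal.ofReal_le_ofReal (cauchyPDF_le_of_abs_le ?_)
          rw [abs_of_nonneg hu, abs_of_nonneg (hu.trans (hua.trans hx.1))]
          exact hua.trans hx.1
      _ = ENNReal.ofReal (Real.pi⁻¹ * (1 + u ^ 2)⁻¹) * volume (Icc a b) := setLIntegral_const _ _
      _ = ENNReal.ofReal ((b - a) * (Real.pi⁻¹ * (1 + u ^ 2)⁻¹)) := by
          rw [Real.volume_Icc, ← ENNReal.ofReal_mul (cauchyPDF_pos u).le, mul_comm (b - a)]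
  · rw [Icc_eq_empty (not_le.2 hab), measure_empty]
    exact bot_le

/-- Lower bound: on an interval `[a, b] ⊆ [-u, u]` the Cauchy law has mass `≥ (b - a)·π⁻¹(1+u²)⁻¹` (trivial if `b < a`). -/
theorem le_cauchy_Icc {u a b : ℝ} (ha : -u ≤ a) (hb : b ≤ u) :
    ENNReal.ofReal ((b - a) * (Real.pi⁻¹ * (1 + u ^ 2)⁻¹))
      ≤ (volume.withDensity fun x : ℝ => ENNReal.ofReal (Real.pi⁻¹ * (1 + x ^ 2)⁻¹)) (Icc a b) := by
  rw [cauchy_apply measurableSet_Icc]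
  calc ENNReal.ofReal ((b - a) * (Real.pi⁻¹ * (1 + u ^ 2)⁻¹))
      = ENNReal.ofReal (Real.pi⁻¹ * (1 + u ^ 2)⁻¹) * volume (Icc a b) := by
        rw [Real.volume_Icc, ← ENNReal.ofReal_mul (cauchyPDF_pos u).le, mul_comm (b - a)]
    _ = ∫⁻ _ in Icc a b, ENNReal.ofReal (Real.pi⁻¹ * (1 + u ^ 2)⁻¹) := (setLIntegral_const _ _).symm
    _ ≤ ∫⁻ x in Icc a b, ENNReal.ofReal (Real.pi⁻¹ * (1 + x ^ 2)⁻¹) := by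
        refine setLIntegral_mono measurable_cauchyPDF_ennreal fun x hx => ?_
        refine ENNReal.ofReal_le_ofReal (cauchyPDF_le_of_abs_le ?_)
        rw [abs_le]
        constructor
        · linarith [le_abs_self u, hx.1]
        · linarith [le_abs_self u, hx.2]

/-- The preimage of an interval under `ξ ↦ Eξ`, `E > 0`. -/
theorem setOf_mul_mem_Icc {E : ℝ} (hE : 0 < E) (u v : ℝ) :
    {x : ℝ | E * x ∈ Icc u v} = Icc (u / E) (v / E) := by
  ext x
  simp only [mem_setOf_eq, mem_Icc]
  rw [le_div_iff₀ hE, div_le_iff₀ hE, mul_comm x E]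

/-- **Scale-free monotonicity of the Cauchy kernel.**  For `E > 0`, an inner interval `[u', v'] ⊆ [-u, u]` and an outer
interval `[u, v]` of length `≤ ℓ` (`0 < ℓ`):  `(v' - u')/ℓ · C{ξ : Eξ ∈ [u, v]} ≤ C{ξ : Eξ ∈ [u', v']}`.
(The density at every point of the inner preimage dominates the density at every point of the outer one; the scale `E`
cancels.) -/
theorem cauchy_preimage_mul_Icc_ratio {E u v u' v' ℓ : ℝ} (hE : 0 < E) (hu'v' : u' ≤ v')
    (hu' : -u ≤ u') (hv' : v' ≤ u) (hℓ : v - u ≤ ℓ) (hℓ0 : 0 < ℓ) :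
    ENNReal.ofReal ((v' - u') / ℓ) *
        (volume.withDensity fun x : ℝ => ENNReal.ofReal (Real.pi⁻¹ * (1 + x ^ 2)⁻¹)) {x : ℝ | E * x ∈ Icc u v}
      ≤ (volume.withDensity fun x : ℝ => ENNReal.ofReal (Real.pi⁻¹ * (1 + x ^ 2)⁻¹)) {x : ℝ | E * x ∈ Icc u' v'} := by
  have hu0 : 0 ≤ u := by linarith
  rw [setOf_mul_mem_Icc hE, setOf_mul_mem_Icc hE]
  set d : ℝ := Real.pi⁻¹ * (1 + (u / E) ^ 2)⁻¹ with hd_def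
  have hd : 0 ≤ d := (cauchyPDF_pos (u / E)).le
  calc ENNReal.ofReal ((v' - u') / ℓ) *
        (volume.withDensity fun x : ℝ => ENNReal.ofReal (Real.pi⁻¹ * (1 + x ^ 2)⁻¹)) (Icc (u / E) (v / E))
      ≤ ENNReal.ofReal ((v' - u') / ℓ) * ENNReal.ofReal ((v / E - u / E) * d) := by
        gcongr
        exact cauchy_Icc_le (u := u / E) (by positivity) le_rfl
    _ = ENNReal.ofReal ((v' - u') / ℓ * ((v / E - u / E) * d)) :=
        (ENNReal.ofReal_mul (div_nonneg (sub_nonneg.2 hu'v') hℓ0.le)).symm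
    _ ≤ ENNReal.ofReal ((v' / E - u' / E) * d) := by
        apply ENNReal.ofReal_le_ofReal
        have h1 : (v - u) / ℓ ≤ 1 := (div_le_one hℓ0).2 hℓ
        have hX : 0 ≤ (v' - u') / E * d := mul_nonneg (div_nonneg (sub_nonneg.2 hu'v') hE.le) hd
        calc (v' - u') / ℓ * ((v / E - u / E) * d)
            = (v' - u') / E * d * ((v - u) / ℓ) := by
              rw [← sub_div]
              ring
          _ ≤ (v' - u') / E * d := mul_le_of_le_one_right hX h1
          _ = (v' / E - u' / E) * d := by rw [sub_div]
    _ ≤ (volume.withDensity fun x : ℝ => ENNReal.ofReal (Real.pi⁻¹ * (1 + x ^ 2)⁻¹)) (Icc (u' / E) (v' / E)) := by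
        refine le_cauchy_Icc ?_ ?_
        · rw [← neg_div]; exact div_le_div_of_nonneg_right hu' hE.le
        · exact div_le_div_of_nonneg_right hv' hE.le

/-- **Cauchy tail on a far box.**  For `0 < E` and `ρ ≥ 0`: `C{ξ : Eξ ∈ [ρ, ρ+1]} ≥ π⁻¹ E/(E² + (ρ+1)²)`. -/
theorem le_cauchy_preimage_mul_Icc_far {E ρ : ℝ} (hE : 0 < E) (hρ : 0 ≤ ρ) :
    ENNReal.ofReal (Real.pi⁻¹ * (E / (E ^ 2 + (ρ + 1) ^ 2)))
      ≤ (volume.withDensity fun x : ℝ => ENNReal.ofReal (Real.pi⁻¹ * (1 + x ^ 2)⁻¹))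
          {x : ℝ | E * x ∈ Icc ρ (ρ + 1)} := by
  rw [setOf_mul_mem_Icc hE]
  have e : Real.pi⁻¹ * (E / (E ^ 2 + (ρ + 1) ^ 2))
      = ((ρ + 1) / E - ρ / E) * (Real.pi⁻¹ * (1 + ((ρ + 1) / E) ^ 2)⁻¹) := by
    have hE' : E ≠ 0 := hE.ne'
    field_simp
    ring
  rw [e]
  refine le_cauchy_Icc ?_ le_rfl
  have : 0 ≤ ρ / E := by positivity
  have : 0 ≤ (ρ + 1) / E := by positivity
  linarith


/-- Real form of the characteristic function of the Cauchy law: `∫ cos(tξ) dC(ξ) = e^{-|t|}`. -/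
theorem integral_cos_cauchy (t : ℝ) :
    ∫ x : ℝ, Real.cos (t * x) ∂(volume.withDensity fun x : ℝ => ENNReal.ofReal (Real.pi⁻¹ * (1 + x ^ 2)⁻¹))
      = Real.exp (-|t|) := by
  haveI := isProbabilityMeasure_cauchy
  have h := congrArg Complex.re (integral_cexp_cauchy t)
  have hint : Integrable (fun x : ℝ => Complex.exp ((t : ℂ) * (x : ℂ) * Complex.I))
      (volume.withDensity fun x : ℝ => ENNReal.ofReal (Real.pi⁻¹ * (1 + x ^ 2)⁻¹)) := by
    refine Integrable.of_bound (by fun_prop) 1 (ae_of_all _ fun x => ?_)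
    rw [show (t : ℂ) * (x : ℂ) * Complex.I = ((t * x : ℝ) : ℂ) * Complex.I by push_cast; ring,
      Complex.norm_exp_ofReal_mul_I]
  have h2 := integral_re hint
  simp only [RCLike.re_to_complex] at h2
  rw [← h2, Complex.ofReal_re] at h
  rw [← h]
  refine integral_congr_ae (ae_of_all _ fun x => ?_)
  dsimp only
  rw [show (t : ℂ) * (x : ℂ) * Complex.I = ((t * x : ℝ) : ℂ) * Complex.I by push_cast; ring,
    Complex.exp_ofReal_mul_I_re]

end Summit.QuantumFields.YangMills.Theorems.F4SubCurvatureDoorCauchyKernel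

end
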